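import Summits.QuantumFields.BalabanUV.Beta.GAN24.TaylorTrilinear

/-!
# `BalabanUV.Beta.GAN24.TaylorTrilinearPairing` — binder row G-an2-4 ∕ (CONV-C), S-slot, road «S3-Taylor», DIFF row R3-dW:
# generic leaf, PART 2 of 7 — THE SECOND-ORDER REMAINDER OF A LEG AND ITS PAIRING WITH A BOX-LIPSCHITZ WEIGHT
# (second order by ONE Abel summation)

G-an2-4 formalisation swarm, leaf prover 15 (unit `b2b-balaban-gan24-formalise-leaf-15`, gen 14; DIFF row R3-dW holder, INTENT
CLAIMS.log l.4908).  HONEST FRAMING (cell rule, verbatim): «discharging `BetaPertH` makes Bałaban's UV stability UNCONDITIONAL — a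
real constructive-QFT result; it is NOT the continuum limit and NOT the Clay problem.»  HONEST DEPENDENCY (verbatim): «continuum YM
on T⁴ ⇐ BetaPertH ∧ nine spine estimates (0/9 proved); BetaPertH ⇐ (D1) ∧ (D4) ∧ CAP+tail; G-an2-4 gates asym, D1 and NE2/3/4.»
NOT IN PRINT; OUR BOOKKEEPING ([folklore]): elementary real analysis ∕ finite algebra on `ℤ^{d+1}`, GENERIC `d`, GENERIC blockings,
ABSTRACT legs and table; NO object of an2's typed `U = 1` system occurs, nothing is cited, no `def … : Prop`, NOTHING is asserted
or discharged of «E3Shape»∕«E3SupRate» (OPEN, not in print), of (hS, hSall), of the K-slot, of `BetaPertH`.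
NOT BetaPertH, NOT continuum, NOT Clay.

CONTEXT (asserted nowhere below).  The RATE table of the S-slot (`GAN24/StencilSlotE3RateOfPieces.e3SupRate_of_pieces`,
row owner gan24-p1) has the DIFFERENCE row R3-dW: the Wilson piece of the normalised third jet at member `n+3` (blocking
`N′ = N·Lc`) minus the one at member `n+2` (blocking `N`), `≤ cW·θ^{n+1}`.  By `E3UnitSplit.e3W_unit_split` both are (at
`d = 3`, residual `1`) the SAME unit sandwich functional — three legs, one block average, ONE explicit factor of the blocking
on the SAME translation-invariant zero-row-sum table `wilsonA` — read at two blockings.  This chain of generic leaves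
(`TaylorTrilinearCarry` ∕ `…Pairing` ∕ `…DiffSlices` ∕ `…DiffSummed` ∕ `…Transport` ∕ `…TransportBound` ∕ `…Diff`) proves the
two-level difference bound `TaylorTrilinearDiff.trilinear_diff_bound`: TRANSPORT the level-`N` legs to the finer lattice by
`quo Lc` (piecewise constant on cells), split trilinearly — the couplings «(N1-Cauchy)» enter BY THEIR SUP ONLY thanks to ONE
ABEL SUMMATION in the vertex location — and compare the transported functional with the original one EXACTLY through the
CARRY TABLE of a cell (Hermite's identity: same row sum, same first moments ⇒ second order ⇒ `O(1/N)` by the pairing lemma).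

## What is proved ([folklore], `0 sorry`; ONE plumbing `def`: `rem2 F b v := F (v+b) − F v − Σ_j b_j·(F (v+e_j) − F v)`)
* §1 `rem2`, `rem2_zero`, `rem2_step` (one lattice-path step of the remainder is a DIFFERENCE OF UNIT GRADIENTS), `tsum_mul_shift`
  (ABEL: `Σ'_v A v·X (v+c) = Σ'_v A (v−c)·X v`, unconditional), `abs_rem2_le` (first-order size), `summable_of_dominated₃`,
  `unit_step_shift_le`, `summable_pairing_rem2`, **`abs_tsum_pairing_rem2_le`** — THE PAIRING LEMMA: for `A` two-centre dominated
  and BOX-LIPSCHITZ (`|A (v−b) − A v| ≤ α_A·weight`, `|b|₁ ≤ R`) and `F` with unit gradients `β_F·weight`,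
  `|Σ'_v A v · rem2 F b v| ≤ |b|₁·α_A·β_F·(three-centre lattice sum)` — `O(R²/N²)` although `rem2` is `O(R/N)` pointwise.
* §2 `l1_neg`, `l1_le_of_natl1_le`, **`abs_prod_shift_sub_le`** (a PRODUCT of two legs with unit gradients is box-Lipschitz:
  `(R/N)·e^{2δR}·(C′_H C_K + C_H C′_K)`), `abs_boxstep_le` (box steps from unit steps).
* §3 `abs_sum5_le`, `summable_of_le_three` (bookkeeping for the slice files).
-/

noncomputable section

open Finset
open scoped BigOperators
open Literature.MathematicalPhysics.QuantumFieldTheory Balaban1983to89 Balaban1983to89.Beta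
open B12Sec2to5 (l1 l1_nonneg)
open ExpKernelCalculus (Zl l1_sub_triangle l1_sub_symm)
open LatticeForm (quo)

namespace Summit.QuantumFields.BalabanUV.Beta.GAN24.TaylorTrilinearPairing

open Summit.QuantumFields.BalabanUV.Beta.GAN24.TaylorTrilinearLattice

variable {d : ℕ}

/-! ## §1 The second-order Taylor remainder of a leg and its PAIRING with a box-Lipschitz weight (one Abel summation) -/

/-- [folklore] THE SECOND-ORDER REMAINDER of `F` at offset `b`: `F (v+b) − F v − Σ_j b_j·(F (v+e_j) − F v)`. -/
def rem2 (F : (Fin (d + 1) → ℤ) → ℝ) (b v : Fin (d + 1) → ℤ) : ℝ :=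
  F (v + b) - F v - ∑ j, (b j : ℝ) * (F (v + Pi.single j 1) - F v)

/-- [folklore] The remainder at offset `0` vanishes. -/
theorem rem2_zero (F : (Fin (d + 1) → ℤ) → ℝ) (v : Fin (d + 1) → ℤ) : rem2 F 0 v = 0 := by
  simp [rem2]

/-- [folklore] ONE PATH STEP of the remainder: for `b = b' + σ·e_j`,
`rem2 F b v − rem2 F b' v = F (v+b) − F (v+b') − σ·(F (v+e_j) − F v)`. -/
theorem rem2_step (F : (Fin (d + 1) → ℤ) → ℝ) {b b' : Fin (d + 1) → ℤ} {j : Fin (d + 1)} {σ : ℤ}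
    (hb : b = b' + Pi.single j σ) (v : Fin (d + 1) → ℤ) :
    rem2 F b v - rem2 F b' v = F (v + b) - F (v + b') - (σ : ℝ) * (F (v + Pi.single j 1) - F v) := by
  have hsum : ∑ i, ((b i : ℝ) - (b' i : ℝ)) * (F (v + Pi.single i 1) - F v) =
      (σ : ℝ) * (F (v + Pi.single j 1) - F v) := by
    rw [Finset.sum_eq_single j]
    · rw [hb, Pi.add_apply, Pi.single_eq_same]; push_cast; ring
    · intro i _ hi
      rw [hb, Pi.add_apply, Pi.single_eq_of_ne hi]; push_cast; ring
    · intro h; exact absurd (Finset.mem_univ j) h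
  simp only [rem2]
  rw [← hsum]
  simp only [sub_mul, Finset.sum_sub_distrib]
  ring

/-- [folklore] ABEL SUMMATION (lattice reindexing): `Σ'_v A v · X (v + c) = Σ'_v A (v − c) · X v` — unconditional. -/
theorem tsum_mul_shift (A X : (Fin (d + 1) → ℤ) → ℝ) (c : Fin (d + 1) → ℤ) :
    ∑' v, A v * X (v + c) = ∑' v, A (v - c) * X v := by
  rw [← (Equiv.addRight c).tsum_eq fun v => A (v - c) * X v]
  exact tsum_congr fun v => by simp

/-- [folklore] First-order size of the remainder from unit gradients:
`|rem2 F c v| ≤ |c|₁·β·(e^{δ|c|₁} + 1)·e^{−δ|quo N v − a|₁}`. -/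
theorem abs_rem2_le (N : ℕ) [NeZero N] {F : (Fin (d + 1) → ℤ) → ℝ} {β δ : ℝ} {a : Fin (d + 1) → ℤ}
    (hβ : 0 ≤ β) (hδ : 0 ≤ δ) (hF' : ∀ v j, |F (v + Pi.single j 1) - F v| ≤ β * Real.exp (-δ * l1 (quo N v - a)))
    (c v : Fin (d + 1) → ℤ) :
    |rem2 F c v| ≤ l1 c * β * (Real.exp (δ * l1 c) + 1) * Real.exp (-δ * l1 (quo N v - a)) := by
  have h1 := abs_sub_le_of_unit_steps N hβ hδ (fun z ν => hF' z ν) v c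
  have h2 : |∑ j, (c j : ℝ) * (F (v + Pi.single j 1) - F v)| ≤ l1 c * β * Real.exp (-δ * l1 (quo N v - a)) := by
    calc |∑ j, (c j : ℝ) * (F (v + Pi.single j 1) - F v)|
        ≤ ∑ j, |(c j : ℝ) * (F (v + Pi.single j 1) - F v)| := Finset.abs_sum_le_sum_abs _ _
      _ ≤ ∑ j, |(c j : ℝ)| * (β * Real.exp (-δ * l1 (quo N v - a))) := Finset.sum_le_sum fun j _ => by
            rw [abs_mul]; exact mul_le_mul_of_nonneg_left (hF' v j) (abs_nonneg _)
      _ = l1 c * β * Real.exp (-δ * l1 (quo N v - a)) := by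
            have hl : ∑ j, |(c j : ℝ)| = l1 c := by simp [l1]
            rw [← Finset.sum_mul, hl]; ring
  unfold rem2
  calc |F (v + c) - F v - ∑ j, (c j : ℝ) * (F (v + Pi.single j 1) - F v)|
      ≤ |F (v + c) - F v| + |∑ j, (c j : ℝ) * (F (v + Pi.single j 1) - F v)| := abs_sub _ _
    _ ≤ l1 c * β * Real.exp (δ * l1 c) * Real.exp (-δ * l1 (quo N v - a)) +
          l1 c * β * Real.exp (-δ * l1 (quo N v - a)) := add_le_add h1 h2
    _ = _ := by ring

section Pairing

variable (N : ℕ) [NeZero N] {A F : (Fin (d + 1) → ℤ) → ℝ} {δ CA αA βF : ℝ} {a₁ a₂ a₃ : Fin (d + 1) → ℤ} {R : ℕ}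

/-- [folklore] Summability of a two-centre-dominated weight against a one-centre-dominated factor. -/
theorem summable_of_dominated₃ (hδ : 0 < δ) {X Y : (Fin (d + 1) → ℤ) → ℝ} {cX cY : ℝ}
    (hX : ∀ v, |X v| ≤ cX * Real.exp (-δ * (l1 (quo N v - a₁) + l1 (quo N v - a₂))))
    (hY : ∀ v, |Y v| ≤ cY * Real.exp (-δ * l1 (quo N v - a₃))) :
    Summable fun v => X v * Y v := by
  have hcX : 0 ≤ cX := TaylorBlockSum.nonneg_of_dominated (Real.exp_pos _) (hX 0)
  refine Summable.of_norm_bounded ((summable_exp_quo_three N hδ a₁ a₂ a₃).mul_left (cX * cY)) fun v => ?_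
  rw [Real.norm_eq_abs, abs_mul]
  calc |X v| * |Y v| ≤ (cX * Real.exp (-δ * (l1 (quo N v - a₁) + l1 (quo N v - a₂)))) *
        (cY * Real.exp (-δ * l1 (quo N v - a₃))) :=
        mul_le_mul (hX v) (hY v) (abs_nonneg _) (by positivity)
    _ = cX * cY * Real.exp (-δ * (l1 (quo N v - a₁) + l1 (quo N v - a₂) + l1 (quo N v - a₃))) := by
        rw [show -δ * (l1 (quo N v - a₁) + l1 (quo N v - a₂) + l1 (quo N v - a₃)) =
          -δ * (l1 (quo N v - a₁) + l1 (quo N v - a₂)) + -δ * l1 (quo N v - a₃) by ring, Real.exp_add]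
        ring

/-- [folklore] A shifted unit gradient is dominated at the unshifted point (price `e^{δ|c|₁}`). -/
theorem unit_step_shift_le (hδ : 0 ≤ δ) (hβF : 0 ≤ βF)
    (hF' : ∀ v j, |F (v + Pi.single j 1) - F v| ≤ βF * Real.exp (-δ * l1 (quo N v - a₃)))
    (c v : Fin (d + 1) → ℤ) (j : Fin (d + 1)) :
    |F (v + c + Pi.single j 1) - F (v + c)| ≤ βF * Real.exp (δ * l1 c) * Real.exp (-δ * l1 (quo N v - a₃)) := by
  have h := weight_shift_le N hδ hβF v c a₃ (hF' (v + c) j)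
  simpa only [mul_assoc] using h

/-- [folklore] Summability of the pairing of a two-centre dominated weight with a second-order remainder. -/
theorem summable_pairing_rem2 (hδ : 0 < δ) (hβF : 0 ≤ βF)
    (hA : ∀ v, |A v| ≤ CA * Real.exp (-δ * (l1 (quo N v - a₁) + l1 (quo N v - a₂))))
    (hF' : ∀ v j, |F (v + Pi.single j 1) - F v| ≤ βF * Real.exp (-δ * l1 (quo N v - a₃))) (c : Fin (d + 1) → ℤ) :
    Summable fun v => A v * rem2 F c v :=
  summable_of_dominated₃ N hδ hA (fun v => abs_rem2_le N hβF hδ.le hF' c v)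

/-- [folklore] **THE PAIRING LEMMA (second order by ONE Abel summation).**  Let `A` be two-centre block-label dominated
and BOX-LIPSCHITZ — `|A (v − b) − A v| ≤ α_A · e^{−δ(|quo N v − a₁|₁ + |quo N v − a₂|₁)}` for all offsets `|b|₁ ≤ R`
(typically `A` = a product of two legs, `α_A = O(R/N)`) — and let `F` have unit gradients
`|F (v+e_j) − F v| ≤ β_F · e^{−δ|quo N v − a₃|₁}` (`β_F = O(1/N)`).  Then for every offset `|b|₁ ≤ R` the lattice
pairing of `A` with the SECOND-ORDER REMAINDER of `F` obeys
`|Σ'_v A v · rem2 F b v| ≤ |b|₁ · α_A · β_F · Σ'_v e^{−δ(|quo N v − a₁|₁ + |quo N v − a₂|₁ + |quo N v − a₃|₁)}`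
— `O(R²/N²)` times a three-centre block sum, although POINTWISE `rem2 F b v` is only `O(R/N)`: along a lattice path
each step of the remainder is a DIFFERENCE OF UNIT GRADIENTS `∇_j F (v + b′) − ∇_j F v`, which is moved onto `A` by the
reindexing `Σ'_v A v·∇_j F (v + b′) = Σ'_v A (v − b′)·∇_j F v`. -/
theorem abs_tsum_pairing_rem2_le (hδ : 0 < δ) (hαA : 0 ≤ αA) (hβF : 0 ≤ βF)
    (hA : ∀ v, |A v| ≤ CA * Real.exp (-δ * (l1 (quo N v - a₁) + l1 (quo N v - a₂))))
    (hA' : ∀ v b, LatticeForm.l1 b ≤ R →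
      |A (v - b) - A v| ≤ αA * Real.exp (-δ * (l1 (quo N v - a₁) + l1 (quo N v - a₂))))
    (hF' : ∀ v j, |F (v + Pi.single j 1) - F v| ≤ βF * Real.exp (-δ * l1 (quo N v - a₃)))
    {b : Fin (d + 1) → ℤ} (hb : LatticeForm.l1 b ≤ R) :
    |∑' v, A v * rem2 F b v| ≤ (LatticeForm.l1 b : ℝ) * αA * βF *
      ∑' v, Real.exp (-δ * (l1 (quo N v - a₁) + l1 (quo N v - a₂) + l1 (quo N v - a₃))) := by
  set ω₂ : (Fin (d + 1) → ℤ) → ℝ := fun v => Real.exp (-δ * (l1 (quo N v - a₁) + l1 (quo N v - a₂))) with hω₂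
  set ω₁ : (Fin (d + 1) → ℤ) → ℝ := fun v => Real.exp (-δ * l1 (quo N v - a₃)) with hω₁
  set S : ℝ := ∑' v, Real.exp (-δ * (l1 (quo N v - a₁) + l1 (quo N v - a₂) + l1 (quo N v - a₃))) with hS
  have hCA : 0 ≤ CA := TaylorBlockSum.nonneg_of_dominated (Real.exp_pos _) (hA 0)
  have hω₃ : ∀ v, ω₂ v * ω₁ v = Real.exp (-δ * (l1 (quo N v - a₁) + l1 (quo N v - a₂) + l1 (quo N v - a₃))) := by
    intro v; rw [hω₂, hω₁, ← Real.exp_add]; ring_nf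
  have hSsum : Summable fun v => ω₂ v * ω₁ v := by
    simp_rw [hω₃]; exact summable_exp_quo_three N hδ a₁ a₂ a₃
  -- summability of the pairings that occur
  have hsumR : ∀ c, Summable fun v => A v * rem2 F c v := fun c =>
    summable_of_dominated₃ N hδ hA (fun v => abs_rem2_le N hβF hδ.le hF' c v)
  have hsumG : ∀ c j, Summable fun v => A v * (F (v + c + Pi.single j 1) - F (v + c)) := fun c j =>
    summable_of_dominated₃ N hδ hA (fun v => unit_step_shift_le N hδ.le hβF hF' c v j)
  -- the Abel step: a difference of unit gradients paired with `A`
  have habel : ∀ c j, LatticeForm.l1 c ≤ R →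
      |∑' v, A v * ((F (v + c + Pi.single j 1) - F (v + c)) - (F (v + Pi.single j 1) - F v))| ≤ αA * βF * S := by
    intro c j hc
    have hG0 := hsumG 0 j
    simp only [add_zero] at hG0
    have e1 : ∑' v, A v * ((F (v + c + Pi.single j 1) - F (v + c)) - (F (v + Pi.single j 1) - F v)) =
        ∑' v, (A (v - c) - A v) * (F (v + Pi.single j 1) - F v) := by
      have h1 : ∑' v, A v * ((F (v + c + Pi.single j 1) - F (v + c)) - (F (v + Pi.single j 1) - F v)) =
          ∑' v, A v * (F (v + c + Pi.single j 1) - F (v + c)) - ∑' v, A v * (F (v + Pi.single j 1) - F v) := by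
        rw [← (hsumG c j).tsum_sub hG0]; exact tsum_congr fun v => by ring
      have h2 := tsum_mul_shift A (fun w => F (w + Pi.single j 1) - F w) c
      have hG1 : Summable fun v => A (v - c) * (F (v + Pi.single j 1) - F v) := by
        have := (Equiv.subRight c).summable_iff.2 (hsumG c j)
        refine this.congr fun v => ?_
        simp only [Function.comp_apply, Equiv.subRight_apply, sub_add_cancel]
      rw [h1, h2, ← hG1.tsum_sub hG0]
      exact tsum_congr fun v => by ring
    rw [e1]
    have hpt : ∀ v, ‖(A (v - c) - A v) * (F (v + Pi.single j 1) - F v)‖ ≤ αA * βF * (ω₂ v * ω₁ v) := by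
      intro v
      rw [Real.norm_eq_abs, abs_mul]
      calc |A (v - c) - A v| * |F (v + Pi.single j 1) - F v| ≤ (αA * ω₂ v) * (βF * ω₁ v) :=
            mul_le_mul (hA' v c hc) (hF' v j) (abs_nonneg _) (by positivity)
        _ = αA * βF * (ω₂ v * ω₁ v) := by ring
    have hb := tsum_of_norm_bounded (hSsum.mul_left (αA * βF)).hasSum hpt
    rw [Real.norm_eq_abs, tsum_mul_left] at hb
    simp_rw [hω₃] at hb
    exact hb
  -- induction on the lattice path length
  suffices H : ∀ n : ℕ, n ≤ R → ∀ b : Fin (d + 1) → ℤ, LatticeForm.l1 b = n →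
      |∑' v, A v * rem2 F b v| ≤ (n : ℝ) * αA * βF * S by
    exact H _ hb b rfl
  intro n
  induction n with
  | zero =>
    intro _ b hb0
    rw [(LatticeForm.l1_eq_zero_iff b).1 hb0]
    simp [rem2_zero]
  | succ n ih =>
    intro hn b hbn
    have hne : b ≠ 0 := by intro h; rw [h] at hbn; simp [LatticeForm.l1] at hbn
    obtain ⟨j, hj⟩ : ∃ j, b j ≠ 0 := by
      by_contra hcon; exact hne (funext fun j => by by_contra h; exact hcon ⟨j, h⟩)
    obtain ⟨σ, hσ, hσj⟩ : ∃ σ : ℤ, (σ = 1 ∨ σ = -1) ∧ 1 ≤ σ * b j := by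
      rcases lt_or_gt_of_ne hj with h | h
      · exact ⟨-1, Or.inr rfl, by omega⟩
      · exact ⟨1, Or.inl rfl, by omega⟩
    set b' : Fin (d + 1) → ℤ := b - Pi.single j σ with hb'
    have hl : LatticeForm.l1 b' = n := by
      have := natl1_sub_single hσ hσj; rw [← hb'] at this; omega
    have hbb' : b = b' + Pi.single j σ := by rw [hb', sub_add_cancel]
    have hih := ih (by omega) b' hl
    -- split the remainder along the last step
    have hsplit : ∑' v, A v * rem2 F b v =
        ∑' v, A v * rem2 F b' v + ∑' v, A v * (rem2 F b v - rem2 F b' v) := by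
      rw [← (hsumR b').tsum_add ((hsumR b).sub (hsumR b') |>.congr fun v => by ring)]
      exact tsum_congr fun v => by ring
    have hstep : |∑' v, A v * (rem2 F b v - rem2 F b' v)| ≤ αA * βF * S := by
      simp_rw [rem2_step F hbb']
      rcases hσ with rfl | rfl
      · -- forward step: `E v = ∇_j F (v + b') − ∇_j F v`
        have e : ∀ v, A v * (F (v + b) - F (v + b') - ((1 : ℤ) : ℝ) * (F (v + Pi.single j 1) - F v)) =
            A v * ((F (v + b' + Pi.single j 1) - F (v + b')) - (F (v + Pi.single j 1) - F v)) := by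
          intro v; rw [hbb', add_assoc]; push_cast; ring
        rw [tsum_congr e]
        exact habel b' j (by omega)
      · -- backward step: `E v = −(∇_j F (v + b) − ∇_j F v)`
        have e : ∀ v, A v * (F (v + b) - F (v + b') - ((-1 : ℤ) : ℝ) * (F (v + Pi.single j 1) - F v)) =
            -(A v * ((F (v + b + Pi.single j 1) - F (v + b)) - (F (v + Pi.single j 1) - F v))) := by
          intro v
          have : v + b' = v + b + Pi.single j 1 := by
            rw [hb', Pi.single_neg]; abel
          rw [this]; push_cast; ring
        rw [tsum_congr e, tsum_neg, abs_neg]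
        exact habel b j (by omega)
    rw [hsplit]
    calc |∑' v, A v * rem2 F b' v + ∑' v, A v * (rem2 F b v - rem2 F b' v)|
        ≤ |∑' v, A v * rem2 F b' v| + |∑' v, A v * (rem2 F b v - rem2 F b' v)| := abs_add_le _ _
      _ ≤ (n : ℝ) * αA * βF * S + αA * βF * S := add_le_add hih hstep
      _ = ((n + 1 : ℕ) : ℝ) * αA * βF * S := by push_cast; ring

end Pairing

/-! ## §2 The box-Lipschitz weight of the pairing: a PRODUCT OF TWO LEGS with unit gradients -/

/-- [folklore] The real `ℓ¹` size is even. -/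
theorem l1_neg (b : Fin (d + 1) → ℤ) : l1 (-b) = l1 b := by
  simp [l1]

/-- [folklore] The real `ℓ¹` size of an offset of `ℕ`-size `≤ R` is `≤ R`. -/
theorem l1_le_of_natl1_le {b : Fin (d + 1) → ℤ} {R : ℕ} (hb : LatticeForm.l1 b ≤ R) : l1 b ≤ R := by
  rw [← cast_natl1]; exact_mod_cast hb

/-- [folklore] **A PRODUCT OF TWO LEGS IS BOX-LIPSCHITZ** (the hypothesis (hA′) of `abs_tsum_pairing_rem2_le` for
`A := H·K`): block-label decay `C_H`, `C_K` and unit gradients `C′_H/N`, `C′_K/N` give, for every offset `|b|₁ ≤ R`,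
`|H (v−b)·K (v−b) − H v·K v| ≤ (R/N)·e^{2δR}·(C′_H C_K + C_H C′_K)·e^{−δ(|quo N v − a₁|₁ + |quo N v − a₂|₁)}`. -/
theorem abs_prod_shift_sub_le (N : ℕ) [NeZero N] {H K : (Fin (d + 1) → ℤ) → ℝ} {CH CH' CK CK' δ : ℝ}
    {a₁ a₂ : Fin (d + 1) → ℤ} {R : ℕ} (hδ : 0 ≤ δ) (hCH' : 0 ≤ CH') (hCK' : 0 ≤ CK')
    (hH : ∀ v, |H v| ≤ CH * Real.exp (-δ * l1 (quo N v - a₁)))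
    (hH' : ∀ v j, |H (v + Pi.single j 1) - H v| ≤ CH' / N * Real.exp (-δ * l1 (quo N v - a₁)))
    (hK : ∀ v, |K v| ≤ CK * Real.exp (-δ * l1 (quo N v - a₂)))
    (hK' : ∀ v j, |K (v + Pi.single j 1) - K v| ≤ CK' / N * Real.exp (-δ * l1 (quo N v - a₂)))
    (v : Fin (d + 1) → ℤ) {b : Fin (d + 1) → ℤ} (hb : LatticeForm.l1 b ≤ R) :
    |H (v - b) * K (v - b) - H v * K v| ≤ (R / N) * Real.exp (2 * δ * R) * (CH' * CK + CH * CK') *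
      Real.exp (-δ * (l1 (quo N v - a₁) + l1 (quo N v - a₂))) := by
  have hN : (0 : ℝ) < N := by exact_mod_cast Nat.pos_of_ne_zero (NeZero.ne N)
  have hCH : 0 ≤ CH := TaylorBlockSum.nonneg_of_dominated (Real.exp_pos _) (hH 0)
  have hCK : 0 ≤ CK := TaylorBlockSum.nonneg_of_dominated (Real.exp_pos _) (hK 0)
  have hRb : l1 (-b) ≤ R := by rw [l1_neg]; exact l1_le_of_natl1_le hb
  have hR0 : (0 : ℝ) ≤ R := by positivity
  set ω₁ : ℝ := Real.exp (-δ * l1 (quo N v - a₁)) with hω₁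
  set ω₂ : ℝ := Real.exp (-δ * l1 (quo N v - a₂)) with hω₂
  have hvb : v - b = v + -b := sub_eq_add_neg v b
  have e1 : |H (v - b) - H v| ≤ l1 (-b) * (CH' / N) * Real.exp (δ * l1 (-b)) * ω₁ := by
    rw [hvb]; exact abs_sub_le_of_unit_steps N (div_nonneg hCH' hN.le) hδ (fun z ν => hH' z ν) v (-b)
  have e2 : |K (v - b)| ≤ CK * Real.exp (δ * l1 (-b)) * ω₂ := by
    rw [hvb]; exact weight_shift_le N hδ hCK v (-b) a₂ (by rw [← hvb]; exact hK (v - b))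
  have e3 : |K (v - b) - K v| ≤ l1 (-b) * (CK' / N) * Real.exp (δ * l1 (-b)) * ω₂ := by
    rw [hvb]; exact abs_sub_le_of_unit_steps N (div_nonneg hCK' hN.le) hδ (fun z ν => hK' z ν) v (-b)
  have e4 : |H v| ≤ CH * ω₁ := hH v
  have hexp1 : Real.exp (δ * l1 (-b)) ≤ Real.exp (δ * R) := Real.exp_le_exp.2 (by nlinarith)
  have hexp2 : Real.exp (δ * R) ≤ Real.exp (2 * δ * R) := Real.exp_le_exp.2 (by nlinarith)
  have hprod : Real.exp (δ * R) * Real.exp (δ * R) = Real.exp (2 * δ * R) := by rw [← Real.exp_add]; ring_nf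
  have hω : ω₁ * ω₂ = Real.exp (-δ * (l1 (quo N v - a₁) + l1 (quo N v - a₂))) := by
    rw [hω₁, hω₂, ← Real.exp_add]; ring_nf
  have hl0 : 0 ≤ l1 (-b) := l1_nonneg _
  calc |H (v - b) * K (v - b) - H v * K v|
      = |(H (v - b) - H v) * K (v - b) + H v * (K (v - b) - K v)| := by ring_nf
    _ ≤ |H (v - b) - H v| * |K (v - b)| + |H v| * |K (v - b) - K v| := by
        refine (abs_add_le _ _).trans ?_; rw [abs_mul, abs_mul]
    _ ≤ (l1 (-b) * (CH' / N) * Real.exp (δ * l1 (-b)) * ω₁) * (CK * Real.exp (δ * l1 (-b)) * ω₂) +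
          (CH * ω₁) * (l1 (-b) * (CK' / N) * Real.exp (δ * l1 (-b)) * ω₂) :=
        add_le_add (mul_le_mul e1 e2 (abs_nonneg _) (by positivity)) (mul_le_mul e4 e3 (abs_nonneg _) (by positivity))
    _ ≤ (R * (CH' / N) * Real.exp (δ * R) * ω₁) * (CK * Real.exp (δ * R) * ω₂) +
          (CH * ω₁) * (R * (CK' / N) * Real.exp (δ * R) * ω₂) := by gcongr
    _ = R / N * (CH' * CK * (Real.exp (δ * R) * Real.exp (δ * R)) + CH * CK' * Real.exp (δ * R)) * (ω₁ * ω₂) := by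
        ring
    _ ≤ R / N * (CH' * CK * Real.exp (2 * δ * R) + CH * CK' * Real.exp (2 * δ * R)) * (ω₁ * ω₂) := by
        rw [hprod]
        have : 0 ≤ (R : ℝ) / N := div_nonneg hR0 hN.le
        gcongr
    _ = _ := by rw [hω]; ring

/-- [folklore] Unit steps give box steps of size `R·(C′/N)·e^{δR}` for every offset `|b|₁ ≤ R`. -/
theorem abs_boxstep_le (N : ℕ) [NeZero N] {F : (Fin (d + 1) → ℤ) → ℝ} {C' δ : ℝ} {a : Fin (d + 1) → ℤ} {R : ℕ}
    (hδ : 0 ≤ δ) (hC' : 0 ≤ C')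
    (hF' : ∀ v j, |F (v + Pi.single j 1) - F v| ≤ C' / N * Real.exp (-δ * l1 (quo N v - a)))
    (v : Fin (d + 1) → ℤ) {b : Fin (d + 1) → ℤ} (hb : l1 b ≤ R) :
    |F (v + b) - F v| ≤ R * (C' / N) * Real.exp (δ * R) * Real.exp (-δ * l1 (quo N v - a)) := by
  have hN : (0 : ℝ) < N := by exact_mod_cast Nat.pos_of_ne_zero (NeZero.ne N)
  have h := abs_sub_le_of_unit_steps N (div_nonneg hC' hN.le) hδ hF' v b
  have h0 := l1_nonneg b
  have hexp : Real.exp (δ * l1 b) ≤ Real.exp (δ * R) := Real.exp_le_exp.2 (by nlinarith)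
  calc |F (v + b) - F v| ≤ l1 b * (C' / N) * Real.exp (δ * l1 b) * Real.exp (-δ * l1 (quo N v - a)) := h
    _ ≤ R * (C' / N) * Real.exp (δ * R) * Real.exp (-δ * l1 (quo N v - a)) := by gcongr

/-! ## §3 Bookkeeping: five finite sums, three-centre domination -/

/-- [folklore] A termwise bound sums to `|B|²·(d+1)³` times the bound. -/
theorem abs_sum5_le (B : Finset (Fin (d + 1) → ℤ)) {f : (Fin (d + 1) → ℤ) → (Fin (d + 1) → ℤ) →
    Fin (d + 1) → Fin (d + 1) → Fin (d + 1) → ℝ} {X : ℝ} (hf : ∀ t ∈ B, ∀ s ∈ B, ∀ l' l κ, |f t s l' l κ| ≤ X) :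
    |∑ t ∈ B, ∑ s ∈ B, ∑ l' : Fin (d + 1), ∑ l : Fin (d + 1), ∑ κ : Fin (d + 1), f t s l' l κ| ≤
      (B.card : ℝ) ^ 2 * ((d : ℝ) + 1) ^ 3 * X := by
  calc |∑ t ∈ B, ∑ s ∈ B, ∑ l' : Fin (d + 1), ∑ l : Fin (d + 1), ∑ κ : Fin (d + 1), f t s l' l κ|
      ≤ ∑ t ∈ B, ∑ s ∈ B, ∑ l' : Fin (d + 1), ∑ l : Fin (d + 1), ∑ κ : Fin (d + 1), |f t s l' l κ| := by
        refine (Finset.abs_sum_le_sum_abs _ _).trans (Finset.sum_le_sum fun t _ => ?_)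
        refine (Finset.abs_sum_le_sum_abs _ _).trans (Finset.sum_le_sum fun s _ => ?_)
        refine (Finset.abs_sum_le_sum_abs _ _).trans (Finset.sum_le_sum fun l' _ => ?_)
        refine (Finset.abs_sum_le_sum_abs _ _).trans (Finset.sum_le_sum fun l _ => ?_)
        exact Finset.abs_sum_le_sum_abs _ _
    _ ≤ ∑ t ∈ B, ∑ s ∈ B, ∑ l' : Fin (d + 1), ∑ l : Fin (d + 1), ∑ κ : Fin (d + 1), X :=
        Finset.sum_le_sum fun t ht => Finset.sum_le_sum fun s hs => Finset.sum_le_sum fun l' _ =>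
          Finset.sum_le_sum fun l _ => Finset.sum_le_sum fun κ _ => hf t ht s hs l' l κ
    _ = _ := by
        simp only [Finset.sum_const, Finset.card_univ, Fintype.card_fin, nsmul_eq_mul]
        push_cast; ring

/-- [folklore] A three-centre dominated fine family is summable. -/
theorem summable_of_le_three (N : ℕ) [NeZero N] {δ C : ℝ} (hδ : 0 < δ) {x' u' z' : Fin (d + 1) → ℤ}
    {X : (Fin (d + 1) → ℤ) → ℝ}
    (hX : ∀ u, |X u| ≤ C * Real.exp (-δ * (l1 (quo N u - x') + l1 (quo N u - u') + l1 (quo N u - z')))) :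
    Summable X := by
  refine Summable.of_norm_bounded ((summable_exp_quo_three N hδ x' z' u').mul_left C) fun u => ?_
  rw [Real.norm_eq_abs]
  have e : l1 (quo N u - x') + l1 (quo N u - z') + l1 (quo N u - u') =
      l1 (quo N u - x') + l1 (quo N u - u') + l1 (quo N u - z') := by ring
  rw [e]; exact hX u

end Summit.QuantumFields.BalabanUV.Beta.GAN24.TaylorTrilinearPairing

end
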